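import Summits.Langlands.Langlands.Theses.MonodromyRankLadder
import Summits.Langlands.Langlands.Theorems.GenericWDUniqueConj
import HarnessLib

/-!
# `MonodromyRankLadder.GenericIffRankMaximal` (stmt-Langlands-27783), part IV:
the twisted module of a Frobenius-semisimple Weil representation

For a Weil–Deligne representation `W` on a finite-dimensional space `V` over an algebraically
closed field `C` of characteristic `0` with `ρ = W.ρ` Frobenius-semisimple, `exists_twist` packages
the reduction used in `GenericWDU.generic_conj` (A'Campo–Hevesi–Thorne–Whitmore 2026, proof of
Prop. 6.0.5; tree port `Theorems/GenericWDUniqueConj.lean`, whose constructions are repeated here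
verbatim): a twist `ρt` of `ρ` by block scalars on the eigen-grading `V = ⨁ gr k` of a central
Frobenius power (`GenericWDU.exists_eigenGrading`) such that
* `ρt.asModule` is a semisimple `C[W_F]`-module, graded by the `gr k`, bounded;
* (T1) every `Nop` with `ρ(w) Nop = q^{deg w} Nop ρ(w)` is a `C[W_F]`-linear degree `+1` map;
* (T2) conversely every `C[W_F]`-linear degree `+1` map is such an `Nop`, and is nilpotent;
* (T3) under this correspondence, WD-genericity of `(ρ, Nop)` (`Hom_WD((ρ,Nop),(ρ(1),Nop)) = 0`) is
  genericity of the graded module endomorphism (no non-zero degree `-1` endomorphism commuting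
  with it).
lens-2 g26 node twin (decomp-langlands), 2026-08-31.
-/

set_option linter.dupNamespace false

namespace Summit.Langlands.Langlands.Theorems

namespace RankLadderJ

open Module
open Literature.NumberTheory.GaloisRepresentations
open Literature.NumberTheory.GaloisRepresentations.WeilGroup
open Literature.NumberTheory.GaloisRepresentations.IsNonarchimedeanLocalField

/-- **The twisted graded module of a Frobenius-semisimple Weil representation** (see the module
docstring). [A'Campo–Hevesi–Thorne–Whitmore, arXiv:2607.11763, proof of Prop. 6.0.5 (1)–(2); tree
`GenericWDU.generic_conj`] -/
theorem exists_twist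
    {F : Type*} [Field F] [ValuativeRel F] [TopologicalSpace F] [IsNonarchimedeanLocalField F]
    {C : Type*} [Field C] [CharZero C] [IsAlgClosed C]
    {V : Type*} [AddCommGroup V] [Module C V] [FiniteDimensional C V]
    (W : WeilDeligneRep F C V) (hss : W.IsFrobSemisimple) :
    ∃ (ρt : Representation C (WeilGroup F) V)
      (grR : ℕ → Submodule (MonoidAlgebra C (WeilGroup F)) ρt.asModule) (Nb : ℕ),
      IsSemisimpleModule (MonoidAlgebra C (WeilGroup F)) ρt.asModule ∧
      iSupIndep grR ∧ (⨆ k, grR k) = ⊤ ∧ (∀ k, Nb ≤ k → grR k = ⊥) ∧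
      (∀ Nop : V →ₗ[C] V,
        (∀ w, W.ρ w ∘ₗ Nop = ((residueFieldCard F : C) ^ (deg w)) • (Nop ∘ₗ W.ρ w)) →
        ∃ tt : ρt.asModule →ₗ[MonoidAlgebra C (WeilGroup F)] ρt.asModule,
          (∀ x, ρt.asModuleEquiv (tt x) = Nop (ρt.asModuleEquiv x)) ∧
          ∀ k, ∀ x ∈ grR k, tt x ∈ grR (k + 1)) ∧
      (∀ tt : ρt.asModule →ₗ[MonoidAlgebra C (WeilGroup F)] ρt.asModule,
        (∀ k, ∀ x ∈ grR k, tt x ∈ grR (k + 1)) →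
        ∃ Nop : V →ₗ[C] V,
          (∀ w, W.ρ w ∘ₗ Nop = ((residueFieldCard F : C) ^ (deg w)) • (Nop ∘ₗ W.ρ w)) ∧
          IsNilpotent Nop ∧ ∀ x, ρt.asModuleEquiv (tt x) = Nop (ρt.asModuleEquiv x)) ∧
      (∀ (Nop : V →ₗ[C] V) (tt : ρt.asModule →ₗ[MonoidAlgebra C (WeilGroup F)] ρt.asModule),
        (∀ x, ρt.asModuleEquiv (tt x) = Nop (ρt.asModuleEquiv x)) →
        ((∀ f : V →ₗ[C] V,
            (∀ w, f ∘ₗ W.ρ w = ((residueFieldCard F : C) ^ (deg w)) • (W.ρ w ∘ₗ f)) →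
            f ∘ₗ Nop = Nop ∘ₗ f → f = 0) ↔
          ∀ f : ρt.asModule →ₗ[MonoidAlgebra C (WeilGroup F)] ρt.asModule,
            (∀ x ∈ grR 0, f x = 0) → (∀ k, ∀ x ∈ grR (k + 1), f x ∈ grR k) →
            f ∘ₗ tt = tt ∘ₗ f → f = 0)) := by
  classical
  have hmul : IsFrobPow.mul (F := F) := IsFrobPow.mul_holds
  have huniq : IsFrobPow.unique (F := F) := IsFrobPow.unique_holds
  set ρ := W.ρ with hρdef
  have hq0 : (residueFieldCard F : C) ≠ 0 := by exact_mod_cast residueFieldCard_ne_zero F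
  -- Frobenius and a central power
  obtain ⟨Φ, hΦ⟩ := WeilDeligneRep.exists_deg_eq_one (F := F)
  obtain ⟨m, hm, hcommI⟩ := W.exists_commute_pow_of_mem_inertia Φ
  set S : Module.End C V := ρ (Φ ^ m) with hSdef
  have hSinj : Function.Injective S :=
    ((Module.End.isUnit_iff _).mp ((Group.isUnit (Φ ^ m)).map ρ)).1
  have hcommS : ∀ w, S * ρ w = ρ w * S := fun w =>
    (W.commute_ρ_pow_of_forall_inertia hΦ hcommI w).eq
  -- the scaling factor `Q = q ^ m`
  set Q : ℕ := residueFieldCard F ^ m with hQdef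
  have hQ : 1 < Q := Nat.one_lt_pow hm.ne' (one_lt_residueFieldCard F)
  have hQC : ((residueFieldCard F : C) ^ (m : ℤ)) = (Q : C) := by
    rw [hQdef, Nat.cast_pow, zpow_natCast]
  have hdegΦm : deg (Φ ^ m) = m := by rw [WeilDeligneRep.deg_pow, hΦ, mul_one]
  have hSNop : ∀ Nop : V →ₗ[C] V,
      (∀ w, ρ w ∘ₗ Nop = ((residueFieldCard F : C) ^ (deg w)) • (Nop ∘ₗ ρ w)) →
      S ∘ₗ Nop = (Q : C) • (Nop ∘ₗ S) := by
    intro Nop hconj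
    have := hconj (Φ ^ m); rwa [hdegΦm, hQC] at this
  -- the eigen-grading
  obtain ⟨gr, Nb, hind, hsup, hNb, hEle, hstab, hraise, hlower⟩ :=
    GenericWDU.exists_eigenGrading S (hss (Φ ^ m)) hSinj hQ
  have hInt : DirectSum.IsInternal gr :=
    (DirectSum.isInternal_submodule_iff_iSupIndep_and_iSup_eq_top gr).mpr ⟨hind, hsup⟩
  have hρgr : ∀ w k, ∀ x ∈ gr k, ρ w x ∈ gr k := fun w k x hx => hstab (ρ w) (hcommS w).symm k x hx
  have hext : ∀ f g : V →ₗ[C] V, (∀ k, ∀ x ∈ gr k, f x = g x) → f = g :=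
    WeilDeligneRep.linearMap_eq_of_eq_on_iSup gr hsup
  -- the twisting scalars
  let cf : WeilGroup F → ℕ → C := fun w k => (residueFieldCard F : C) ^ (-((k : ℤ) * deg w))
  have hcf_one : ∀ k, cf 1 k = 1 := fun k => by
    change (residueFieldCard F : C) ^ (-((k : ℤ) * deg (1 : WeilGroup F))) = 1
    rw [deg_one hmul huniq, mul_zero, neg_zero, zpow_zero]
  have hcf_mul : ∀ w w' k, cf (w * w') k = cf w k * cf w' k := fun w w' k => by
    change (residueFieldCard F : C) ^ (-((k : ℤ) * deg (w * w'))) = _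
    rw [deg_mul hmul huniq, ← zpow_add₀ hq0]
    congr 1; ring
  have hcf_ne : ∀ w k, cf w k ≠ 0 := fun w k => zpow_ne_zero _ hq0
  have hcf_succ : ∀ w k, cf w (k + 1) * (residueFieldCard F : C) ^ (deg w) = cf w k := fun w k => by
    change (residueFieldCard F : C) ^ (-(((k + 1 : ℕ) : ℤ) * deg w)) * _ = (residueFieldCard F : C) ^ _
    rw [← zpow_add₀ hq0]
    congr 1; push_cast; ring
  have hcf_inertia : ∀ w, w ∈ inertia F → ∀ k, cf w k = 1 := fun w hw k => by
    change (residueFieldCard F : C) ^ (-((k : ℤ) * deg w)) = 1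
    rw [WeilDeligneRep.deg_eq_zero_of_mem_inertia hw, mul_zero, neg_zero, zpow_zero]
  -- block-scalar operators and the twisted representation
  choose D hD using fun w => GenericWDU.exists_blockScalar gr hInt (cf w)
  have hD1 : D 1 = 1 := hext _ _ fun k x hx => by
    rw [hD 1 k x hx, hcf_one, one_smul]; rfl
  have hDmul : ∀ w w', D (w * w') = D w * D w' := fun w w' => hext _ _ fun k x hx => by
    rw [Module.End.mul_apply, hD w' k x hx, map_smul, hD w k x hx, hD (w * w') k x hx, smul_smul,
      hcf_mul, mul_comm]
  have hDρ : ∀ w w', D w * ρ w' = ρ w' * D w := fun w w' => hext _ _ fun k x hx => by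
    rw [Module.End.mul_apply, Module.End.mul_apply, hD w k _ (hρgr w' k x hx), hD w k x hx, map_smul]
  let ρt : Representation C (WeilGroup F) V :=
    { toFun := fun w => ρ w * D w
      map_one' := by rw [map_one, hD1, mul_one]
      map_mul' := fun w w' => by
        rw [map_mul, hDmul, mul_assoc, ← mul_assoc (ρ w'), ← hDρ w w']
        simp only [mul_assoc] }
  have hρt_apply : ∀ w, ρt w = ρ w * D w := fun w => rfl
  have hρt : ∀ w k, ∀ x ∈ gr k, ρt w x = cf w k • ρ w x := fun w k x hx => by
    rw [hρt_apply, Module.End.mul_apply, hD w k x hx, map_smul]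
  have hρtgr : ∀ w k, ∀ x ∈ gr k, ρt w x ∈ gr k := fun w k x hx => by
    rw [hρt w k x hx]; exact Submodule.smul_mem _ _ (hρgr w k x hx)
  have hρt_inertia : ∀ w, w ∈ inertia F → ρt w = ρ w := fun w hw => hext _ _ fun k x hx => by
    rw [hρt w k x hx, hcf_inertia w hw, one_smul]
  -- eigenspaces of `S` are `ρt`-stable
  have hEst : ∀ μ w, ∀ x ∈ S.eigenspace μ, ρt w x ∈ S.eigenspace μ := by
    intro μ w x hx
    obtain ⟨k, hk⟩ := hEle μ
    rw [hρt w k x (hk hx)]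
    refine Submodule.smul_mem _ _ ?_
    rw [Module.End.mem_eigenspace_iff] at hx ⊢
    rw [← Module.End.mul_apply, hcommS w, Module.End.mul_apply, hx, map_smul]
  let Esub : C → Subrepresentation ρt := fun μ => ⟨S.eigenspace μ, fun w x hx => hEst μ w x hx⟩
  -- each eigenspace is a semisimple `W_F`-representation
  have hfinIt : ((fun w => ρt w) '' (inertia F : Set (WeilGroup F))).Finite := by
    refine (W.finite_image_inertia.image Units.val).subset ?_
    rintro _ ⟨i, hi, rfl⟩
    exact ⟨ρ.toHomUnits i, ⟨i, hi, rfl⟩, (hρt_inertia i hi).symm⟩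
  have hEss : ∀ μ : C, μ ≠ 0 → ((Esub μ).toRepresentation).IsSemisimpleRepresentation := by
    intro μ hμ
    obtain ⟨k, hk⟩ := hEle μ
    refine GenericWDU.isSemisimpleRepresentation_of_frobenius_scalar ρt hΦ hm (Esub μ)
      (mul_ne_zero (hcf_ne (Φ ^ m) k) hμ) (fun x hx => ?_) hfinIt
    rw [hρt (Φ ^ m) k x (hk hx), mul_smul]
    congr 1
    exact Module.End.mem_eigenspace_iff.mp hx
  -- hence the twisted module is semisimple
  have hssMod : IsSemisimpleModule (MonoidAlgebra C (WeilGroup F)) ρt.asModule := by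
    refine isSemisimpleModule_of_isSemisimpleModule_submodule (s := {μ : C | μ ≠ 0})
      (p := fun μ => (Esub μ).asSubmodule) ?_ ?_
    · intro μ hμ
      haveI := hEss μ hμ
      have e := Literature.RepresentationTheory.Semisimple.Subrepresentation.asModuleEquiv (Esub μ)
      rw [← e.isSemisimpleModule_iff]
      exact (Representation.isSemisimpleRepresentation_iff_isSemisimpleModule_asModule _).mp (hEss μ hμ)
    · rw [eq_top_iff]
      rintro x -
      have hx : (ρt.asModuleEquiv x : V) ∈ ⨆ μ, S.eigenspace μ := by
        rw [(hss (Φ ^ m)).iSup_eigenspace_eq_top]; exact Submodule.mem_top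
      have key : ∀ v : V, v ∈ (⨆ μ, S.eigenspace μ) →
          ρt.asModuleEquiv.symm v ∈ ⨆ μ ∈ {μ : C | μ ≠ 0}, (Esub μ).asSubmodule := by
        intro v hv
        refine Submodule.iSup_induction _
          (motive := fun v : V => ρt.asModuleEquiv.symm v ∈ ⨆ μ ∈ {μ : C | μ ≠ 0}, (Esub μ).asSubmodule)
          hv ?_ (by rw [map_zero]; exact zero_mem _) ?_
        · intro μ v hv
          by_cases hμ : μ = 0
          · have : v = 0 := by
              rw [hμ, Module.End.eigenspace_zero, LinearMap.mem_ker] at hv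
              exact hSinj (by rw [hv, map_zero])
            rw [this, map_zero]; exact zero_mem _
          · exact Submodule.mem_iSup_of_mem μ (Submodule.mem_iSup_of_mem hμ hv)
        · intro v w hv hw
          rw [map_add]; exact add_mem hv hw
      simpa using key _ hx
  -- the grading over the group algebra
  let GR : ℕ → Subrepresentation ρt := fun k => ⟨gr k, fun w x hx => hρtgr w k x hx⟩
  let grR : ℕ → Submodule (MonoidAlgebra C (WeilGroup F)) ρt.asModule := fun k => (GR k).asSubmodule
  have hmemR : ∀ k (x : ρt.asModule), x ∈ grR k ↔ (ρt.asModuleEquiv x : V) ∈ gr k := fun k x =>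
    Iff.rfl
  have hsupR : ⨆ k, grR k = ⊤ := by
    rw [eq_top_iff]
    rintro x -
    have hx : (ρt.asModuleEquiv x : V) ∈ ⨆ k, gr k := hsup ▸ Submodule.mem_top
    have key : ∀ v : V, v ∈ (⨆ k, gr k) → ρt.asModuleEquiv.symm v ∈ ⨆ k, grR k := by
      intro v hv
      refine Submodule.iSup_induction _ (motive := fun v : V => ρt.asModuleEquiv.symm v ∈ ⨆ k, grR k)
        hv (fun k v hv => Submodule.mem_iSup_of_mem k hv) (by rw [map_zero]; exact zero_mem _) ?_
      intro v w hv hw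
      rw [map_add]; exact add_mem hv hw
    simpa using key _ hx
  have hindR : iSupIndep grR := by
    rw [iSupIndep_def]
    intro i
    rw [Submodule.disjoint_def]
    intro x hx hx'
    have h1 : (ρt.asModuleEquiv x : V) ∈ gr i := hx
    have h2 : (ρt.asModuleEquiv x : V) ∈ ⨆ (j) (_ : j ≠ i), gr j := by
      refine Submodule.iSup_induction _
        (motive := fun y : ρt.asModule => (ρt.asModuleEquiv y : V) ∈ ⨆ (j) (_ : j ≠ i), gr j)
        hx' ?_ (by rw [map_zero]; exact zero_mem _) ?_
      · intro j y hy
        by_cases hj : j ≠ i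
        · rw [iSup_pos hj] at hy
          exact Submodule.mem_iSup_of_mem j (Submodule.mem_iSup_of_mem hj hy)
        · rw [iSup_neg hj, Submodule.mem_bot] at hy
          rw [hy, map_zero]; exact zero_mem _
      · intro y z hy hz
        rw [map_add]; exact add_mem hy hz
    have := (Submodule.disjoint_def.mp (iSupIndep_def.mp hind i)) _ h1 h2
    exact ρt.asModuleEquiv.injective (by rw [this, map_zero])
  have hNbR : ∀ k, Nb ≤ k → grR k = ⊥ := by
    intro k hk
    rw [eq_bot_iff]
    intro x hx
    have : (ρt.asModuleEquiv x : V) ∈ gr k := hx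
    rw [hNb k hk, Submodule.mem_bot] at this
    rw [Submodule.mem_bot]
    exact ρt.asModuleEquiv.injective (by rw [this, map_zero])
  -- `C`-linear maps on `V` versus additive maps on the twisted module
  have hRlin : ∀ (f : ρt.asModule →ₗ[MonoidAlgebra C (WeilGroup F)] ρt.asModule) (w) (x : ρt.asModule),
      f (ρt.asModuleEquiv.symm (ρt w (ρt.asModuleEquiv x))) =
        ρt.asModuleEquiv.symm (ρt w (ρt.asModuleEquiv (f x))) := by
    intro f w x
    have h := f.map_smul (MonoidAlgebra.single w (1 : C)) x
    rw [Representation.single_smul, Representation.single_smul, one_smul, one_smul] at h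
    exact h
  -- (T1)
  have hNt : ∀ (Nop : V →ₗ[C] V), (∀ w, ρ w ∘ₗ Nop = ((residueFieldCard F : C) ^ (deg w)) • (Nop ∘ₗ ρ w)) →
      ∀ w, Nop ∘ₗ ρt w = ρt w ∘ₗ Nop := by
    intro Nop hconj w
    apply hext
    intro k x hx
    rw [LinearMap.comp_apply, LinearMap.comp_apply, hρt w k x hx, map_smul,
      hρt w (k + 1) _ (hraise Nop (hSNop Nop hconj) k x hx)]
    have h1 : ρ w (Nop x) = (residueFieldCard F : C) ^ (deg w) • Nop (ρ w x) := congr($(hconj w) x)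
    rw [h1, smul_smul, hcf_succ]
  have hT1 : ∀ Nop : V →ₗ[C] V,
      (∀ w, ρ w ∘ₗ Nop = ((residueFieldCard F : C) ^ (deg w)) • (Nop ∘ₗ ρ w)) →
      ∃ tt : ρt.asModule →ₗ[MonoidAlgebra C (WeilGroup F)] ρt.asModule,
        (∀ x, ρt.asModuleEquiv (tt x) = Nop (ρt.asModuleEquiv x)) ∧
        ∀ k, ∀ x ∈ grR k, tt x ∈ grR (k + 1) := by
    intro Nop hconj
    exact ⟨Representation.IntertwiningMap.equivLinearMapAsModule ρt ρt ⟨Nop, hNt Nop hconj⟩,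
      fun x => rfl, fun k x hx => hraise Nop (hSNop Nop hconj) k _ hx⟩
  -- (T2)
  have hT2 : ∀ tt : ρt.asModule →ₗ[MonoidAlgebra C (WeilGroup F)] ρt.asModule,
      (∀ k, ∀ x ∈ grR k, tt x ∈ grR (k + 1)) →
      ∃ Nop : V →ₗ[C] V,
        (∀ w, ρ w ∘ₗ Nop = ((residueFieldCard F : C) ^ (deg w)) • (Nop ∘ₗ ρ w)) ∧
        IsNilpotent Nop ∧ ∀ x, ρt.asModuleEquiv (tt x) = Nop (ρt.asModuleEquiv x) := by
    intro tt htt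
    let Nop : V →ₗ[C] V :=
      ρt.asModuleEquiv.toLinearMap ∘ₗ (tt.restrictScalars C) ∘ₗ ρt.asModuleEquiv.symm.toLinearMap
    have hNdef : ∀ v, Nop v = ρt.asModuleEquiv (tt (ρt.asModuleEquiv.symm v)) := fun v => rfl
    have hNtt : ∀ x : ρt.asModule, ρt.asModuleEquiv (tt x) = Nop (ρt.asModuleEquiv x) := fun x => by
      rw [hNdef, LinearEquiv.symm_apply_apply]
    have hNdeg : ∀ k, ∀ x ∈ gr k, Nop x ∈ gr (k + 1) := by
      intro k x hx
      have := htt k (ρt.asModuleEquiv.symm x) (by rw [hmemR, LinearEquiv.apply_symm_apply]; exact hx)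
      rw [hmemR, hNtt, LinearEquiv.apply_symm_apply] at this
      exact this
    have hNρt : ∀ w (v : V), Nop (ρt w v) = ρt w (Nop v) := by
      intro w v
      have h := hRlin tt w (ρt.asModuleEquiv.symm v)
      rw [LinearEquiv.apply_symm_apply] at h
      rw [hNdef, hNdef, h, LinearEquiv.apply_symm_apply]
    refine ⟨Nop, fun w => ?_, ?_, hNtt⟩
    · refine hext _ _ fun k x hx => ?_
      rw [LinearMap.comp_apply, LinearMap.smul_apply, LinearMap.comp_apply]
      have h := hNρt w x
      rw [hρt w k x hx, map_smul, hρt w (k + 1) _ (hNdeg k x hx), ← hcf_succ w k, mul_smul] at h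
      exact (smul_right_injective V (hcf_ne w (k + 1)) h).symm
    · refine ⟨Nb, hext _ _ fun k x hx => ?_⟩
      have := Literature.RepresentationTheory.Semisimple.pow_apply_mem_gr gr Nop hNdeg hx Nb
      rw [hNb (k + Nb) (by omega), Submodule.mem_bot] at this
      rw [this, LinearMap.zero_apply]
  -- (T3)
  have hT3 : ∀ (Nop : V →ₗ[C] V) (tt : ρt.asModule →ₗ[MonoidAlgebra C (WeilGroup F)] ρt.asModule),
      (∀ x, ρt.asModuleEquiv (tt x) = Nop (ρt.asModuleEquiv x)) →
      ((∀ f : V →ₗ[C] V, (∀ w, f ∘ₗ ρ w = ((residueFieldCard F : C) ^ (deg w)) • (ρ w ∘ₗ f)) →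
          f ∘ₗ Nop = Nop ∘ₗ f → f = 0) ↔
        ∀ f : ρt.asModule →ₗ[MonoidAlgebra C (WeilGroup F)] ρt.asModule,
          (∀ x ∈ grR 0, f x = 0) → (∀ k, ∀ x ∈ grR (k + 1), f x ∈ grR k) →
          f ∘ₗ tt = tt ∘ₗ f → f = 0) := by
    intro Nop tt htt
    constructor
    · -- WD-generic ⇒ module-generic (as in `GenericWDU.generic_conj`)
      intro hgenN f hf0 hf1 hft
      let Fv : V →ₗ[C] V :=
        ρt.asModuleEquiv.toLinearMap ∘ₗ (f.restrictScalars C) ∘ₗ ρt.asModuleEquiv.symm.toLinearMap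
      have hFdef : ∀ v, Fv v = ρt.asModuleEquiv (f (ρt.asModuleEquiv.symm v)) := fun v => rfl
      have hFf : ∀ x : ρt.asModule, Fv (ρt.asModuleEquiv x) = ρt.asModuleEquiv (f x) := fun x => by
        rw [hFdef, LinearEquiv.symm_apply_apply]
      have hFρt : ∀ w (v : V), Fv (ρt w v) = ρt w (Fv v) := by
        intro w v
        have h := hRlin f w (ρt.asModuleEquiv.symm v)
        rw [LinearEquiv.apply_symm_apply] at h
        rw [hFdef, hFdef, h, LinearEquiv.apply_symm_apply]
      have hF1 : ∀ w, Fv ∘ₗ ρ w = ((residueFieldCard F : C) ^ (deg w)) • (ρ w ∘ₗ Fv) := by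
        intro w
        refine hext _ _ fun k x hx => ?_
        change Fv (ρ w x) = ((residueFieldCard F : C) ^ (deg w)) • ρ w (Fv x)
        obtain _ | k := k
        · have h0 : Fv (ρ w x) = 0 := by
            have := hf0 (ρt.asModuleEquiv.symm (ρ w x)) (hρgr w 0 x hx)
            have h := hFf (ρt.asModuleEquiv.symm (ρ w x))
            rw [this, map_zero] at h
            simpa using h
          have h0' : Fv x = 0 := by
            have := hf0 (ρt.asModuleEquiv.symm x) hx
            have h := hFf (ρt.asModuleEquiv.symm x)
            rw [this, map_zero] at h
            simpa using h
          rw [h0, h0', map_zero, smul_zero]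
        · have hFx : Fv x ∈ gr k := by
            have := hf1 k (ρt.asModuleEquiv.symm x) hx
            have h := hFf (ρt.asModuleEquiv.symm x)
            rw [LinearEquiv.apply_symm_apply] at h
            rw [h]
            exact this
          have h := hFρt w x
          rw [hρt w (k + 1) x hx, map_smul, hρt w k _ hFx, ← hcf_succ w k, mul_smul] at h
          exact smul_right_injective V (hcf_ne w (k + 1)) h
      have hF2 : Fv ∘ₗ Nop = Nop ∘ₗ Fv := by
        ext v
        have h := congr($hft (ρt.asModuleEquiv.symm v))
        simp only [LinearMap.comp_apply] at h
        have h' := congrArg ρt.asModuleEquiv h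
        rw [htt, ← hFf, ← hFf, htt] at h'
        simpa using h'
      have hF : Fv = 0 := hgenN Fv hF1 hF2
      ext x
      have h := hFf x
      rw [hF, LinearMap.zero_apply] at h
      exact ρt.asModuleEquiv.injective (by rw [← h, LinearMap.zero_apply, map_zero])
    · -- module-generic ⇒ WD-generic
      intro hgen f hf hfN
      have hfS : f ∘ₗ S = (Q : C) • (S ∘ₗ f) := by
        have := hf (Φ ^ m); rwa [hdegΦm, hQC] at this
      obtain ⟨hf0, hf1⟩ := hlower f hfS
      have hfρt : ∀ w, f ∘ₗ ρt w = ρt w ∘ₗ f := by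
        intro w
        refine hext _ _ fun k x hx => ?_
        rw [LinearMap.comp_apply, LinearMap.comp_apply, hρt w k x hx, map_smul]
        have h1 : f (ρ w x) = (residueFieldCard F : C) ^ (deg w) • ρ w (f x) := congr($(hf w) x)
        obtain _ | k := k
        · rw [hf0 _ (hρgr w 0 x hx), hf0 _ hx, map_zero, smul_zero]
        · rw [hρt w k _ (hf1 k x hx), h1, smul_smul, hcf_succ]
      let fR : ρt.asModule →ₗ[MonoidAlgebra C (WeilGroup F)] ρt.asModule :=
        Representation.IntertwiningMap.equivLinearMapAsModule ρt ρt ⟨f, hfρt⟩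
      have hfR : ∀ x, ρt.asModuleEquiv (fR x) = f (ρt.asModuleEquiv x) := fun x => rfl
      have hfR0 : fR = 0 := by
        refine hgen fR (fun x hx => ?_) (fun k x hx => ?_) ?_
        · apply ρt.asModuleEquiv.injective
          rw [hfR, map_zero]
          exact hf0 _ hx
        · rw [hmemR, hfR]
          exact hf1 k _ hx
        · ext x
          apply ρt.asModuleEquiv.injective
          rw [LinearMap.comp_apply, LinearMap.comp_apply, hfR, htt, htt, hfR]
          exact congr($hfN (ρt.asModuleEquiv x))
      ext v
      have h := hfR (ρt.asModuleEquiv.symm v)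
      rw [hfR0, LinearMap.zero_apply, map_zero, LinearEquiv.apply_symm_apply] at h
      rw [← h, LinearMap.zero_apply]
  exact ⟨ρt, grR, Nb, hssMod, hindR, hsupR, hNbR, hT1, hT2, hT3⟩

end RankLadderJ

end Summit.Langlands.Langlands.Theorems
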